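import Mathlib.Geometry.Manifold.ContMDiff.NormedSpace
import Mathlib.Geometry.Manifold.Instances.Real
import Mathlib.Analysis.Calculus.ContDiff.Basic
import Mathlib.Analysis.Complex.Basic

/-!
# Smoothness of the normal velocities of a family of two-chart spheres
(registered helper `helper_normalVelocitySmooth` of line `cross-cap-laurent`, crux
`GromovRecognitionRelEnd`, item stmt-SmoothPoincare4-11009; it serves the child stub
`stub_normalVelocityDichotomy` of the local-foliation fact, item stmt-SmoothPoincare4-16778)

Setting (Wendl 2018, Prop. 2.53, the local foliation by embedded `J`-spheres): `X` a Hausdorff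
second-countable smooth `4`-manifold, an embedded sphere given in two charts `u₀ v₀ : ℂ → X`, a
trivial-normal-bundle witness `(N, πN)` (`N` open, `N ⊇ range u₀ ∪ {v₀ 0}`, `πN : X → ℂ` smooth on
`N`), and a family of two-chart spheres `(U a, V a)`, `‖a‖ < ε`, with `U 0 = u₀`, `V 0 = v₀`,
`V a z = U a z⁻¹` off `z = 0`, both `(a, z) ↦ U a z` and `(a, w) ↦ V a w` being `C^∞` on
`ball 0 ε ×ˢ univ ⊆ ℂ × ℂ`.  The *normal velocity* of the family in the direction `c : ℂ` is
`σ z := fderiv ℝ (fun a => πN (U a z)) 0 c` (and `σ' w := fderiv ℝ (fun a => πN (V a w)) 0 c`).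

Claim (`helper_normalVelocitySmooth`), pure manifold calculus:
(1), (2) `σ` and `σ'` are `C^∞` functions `ℂ → ℂ`;
(3) for `w ≠ 0`, `fderiv ℝ (fun a => πN (V a w)) 0 c = fderiv ℝ (fun a => πN (U a w⁻¹)) 0 c`;
(4), (5) around every `(0, z)` there is an open `S ⊆ ball 0 ε ×ˢ univ` on which `(a, z) ↦ U a z`
maps into `N` and `(a, z) ↦ πN (U a z)` is `C^∞` in the flat sense (`ContDiffOn ℝ ∞` between the
vector spaces `ℂ × ℂ` and `ℂ`); likewise for `V`.

Proof.  (4)/(5): `Φ := fun q => U q.1 q.2` is `ContMDiffOn`, hence continuous, on the open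
`W := ball 0 ε ×ˢ univ`, and `Φ (0, z) = u₀ z ∈ N`; so `S := W ∩ Φ ⁻¹' N` is open
(`ContinuousOn.isOpen_inter_preimage`), contains `(0, z)`, and on it `πN ∘ Φ` is `ContMDiffOn`
between vector spaces (`ContMDiffOn.comp`), i.e. `ContDiffOn` (`contMDiffOn_iff_contDiffOn`).  For
`V` one uses `V 0 w = v₀ w`, which lies in `N`: it is the point `v₀ 0` if `w = 0`, and
`u₀ w⁻¹ ∈ range u₀` otherwise (chart-change relation at `a = 0`).  (1)/(2): on such an `S ∋ (0, z₀)`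
the flat map `g := πN ∘ Φ` is `ContDiffAt` at `(0, z₀)`, and the parametric derivative
`z ↦ fderiv ℝ (fun a => g (a, z)) 0` is `C^∞` at `z₀` by `ContDiffAt.fderiv` (with `∞ + 1 ≤ ∞`),
then evaluate at the constant vector `c` (`ContDiffAt.clm_apply`).  (3): for `w ≠ 0` the two
functions of `a` agree on the neighbourhood `ball 0 ε` of `0`, so their Fréchet derivatives at `0`
agree (`Filter.EventuallyEq.fderiv_eq`).

References: C. Wendl, *Holomorphic Curves in Low Dimensions* (2018), Prop. 2.53 (context only; the
statement proved here is elementary calculus).  No new definitions, notation or instances.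
-/

open scoped Manifold ContDiff Topology
open Set Function Filter

-- the prescribed namespace `Summit.<P>.<Sub>.…` duplicates `SmoothPoincare4` (P = Sub)
set_option linter.dupNamespace false

namespace Summit.SmoothPoincare4.SmoothPoincare4.Theorems.GromovRecognitionRelEnd.CrossCapLaurent

namespace NormalVelocitySmooth

/-- **Local flat packaging.**  If `Φ : ℂ × ℂ → X` is `C^∞` on an open `W`, `πN : X → ℂ` is `C^∞` on
an open `N`, and `Φ p ∈ N` for some `p ∈ W`, then `S := W ∩ Φ ⁻¹' N` is an open neighbourhood of
`p` inside `W`, mapped into `N` by `Φ`, on which `πN ∘ Φ` is `C^∞` in the flat sense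
(`ContDiffOn ℝ ∞` between the vector spaces `ℂ × ℂ` and `ℂ`). [folklore] -/
theorem exists_isOpen_mapsTo_contDiffOn {X : Type*} [TopologicalSpace X]
    [ChartedSpace (EuclideanSpace ℝ (Fin 4)) X] {Φ : ℂ × ℂ → X} {W : Set (ℂ × ℂ)} {N : Set X}
    {πN : X → ℂ} (hW : IsOpen W) (hN : IsOpen N)
    (hΦ : ContMDiffOn 𝓘(ℝ, ℂ × ℂ) (𝓡 4) ∞ Φ W) (hπ : ContMDiffOn (𝓡 4) 𝓘(ℝ, ℂ) ∞ πN N)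
    {p : ℂ × ℂ} (hp : p ∈ W) (hpN : Φ p ∈ N) :
    ∃ S : Set (ℂ × ℂ), IsOpen S ∧ p ∈ S ∧ S ⊆ W ∧ MapsTo Φ S N ∧
      ContDiffOn ℝ ∞ (fun q => πN (Φ q)) S :=
  ⟨W ∩ Φ ⁻¹' N, hΦ.continuousOn.isOpen_inter_preimage hW hN, ⟨hp, hpN⟩, inter_subset_left,
    fun _ hq => hq.2, (hπ.comp (hΦ.mono inter_subset_left) fun _ hq => hq.2).contDiffOn⟩

/-- **Smoothness of a parametric derivative.**  If `g : ℂ × ℂ → ℂ` is `C^∞` on an open set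
`S ∋ (0, z₀)`, then `z ↦ fderiv ℝ (fun a => g (a, z)) 0 c` is `C^∞` at `z₀`: the derivative in the
parameter `a` at `a = 0`, evaluated at a fixed vector `c`, depends smoothly on `z`
(`ContDiffAt.fderiv` with `∞ + 1 ≤ ∞`, then `ContDiffAt.clm_apply`). [folklore] -/
theorem contDiffAt_fderiv_apply {g : ℂ × ℂ → ℂ} {S : Set (ℂ × ℂ)} {z₀ : ℂ} (hS : IsOpen S)
    (h0 : ((0 : ℂ), z₀) ∈ S) (hg : ContDiffOn ℝ ∞ g S) (c : ℂ) :
    ContDiffAt ℝ ∞ (fun z : ℂ => fderiv ℝ (fun a : ℂ => g (a, z)) 0 c) z₀ := by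
  have hga : ContDiffAt ℝ ∞ g (0, z₀) := hg.contDiffAt (hS.mem_nhds h0)
  have hunc : ContDiffAt ℝ ∞ (Function.uncurry fun z a : ℂ => g (a, z)) (z₀, 0) :=
    hga.comp₂ (f₁ := Prod.snd) (f₂ := Prod.fst) (x := (z₀, (0 : ℂ))) contDiffAt_snd contDiffAt_fst
  have hmn : (∞ : WithTop ℕ∞) + 1 ≤ ∞ := le_rfl
  exact (hunc.fderiv (g := fun _ : ℂ => (0 : ℂ)) contDiffAt_const hmn).clm_apply contDiffAt_const

/-- **Equality of parametric derivatives of locally equal families.**  If two families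
`F G : ℂ → ℂ` (functions of the parameter `a`) agree for `‖a‖ < ε` with `0 < ε`, then their Fréchet
derivatives at `a = 0` agree (`Filter.EventuallyEq.fderiv_eq` on the neighbourhood `ball 0 ε`).
[folklore] -/
theorem fderiv_zero_eq_of_eqOn_ball {F G : ℂ → ℂ} {ε : ℝ} (hε : 0 < ε)
    (h : ∀ a : ℂ, ‖a‖ < ε → F a = G a) : fderiv ℝ F 0 = fderiv ℝ G 0 := by
  have hFG : F =ᶠ[𝓝 (0 : ℂ)] G := by
    filter_upwards [Metric.ball_mem_nhds (0 : ℂ) hε] with a ha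
    exact h a (mem_ball_zero_iff.mp ha)
  exact hFG.fderiv_eq

end NormalVelocitySmooth

open NormalVelocitySmooth

/-- **Smoothness of the normal velocities of a family of two-chart spheres** (manifold calculus
behind Wendl 2018, Prop. 2.53).  For a family `(U a, V a)`, `‖a‖ < ε`, of two-chart spheres in a
smooth `4`-manifold `X` (`V a z = U a z⁻¹` off `0`, jointly `C^∞` in `(a, z)` on `ball 0 ε ×ˢ univ`)
through `u₀ = U 0`, `v₀ = V 0`, and a normal witness `(N, πN)` (`N` open, `N ⊇ range u₀ ∪ {v₀ 0}`,
`πN` smooth on `N`): for every direction `c`, (1)/(2) the normal velocities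
`z ↦ fderiv ℝ (fun a => πN (U a z)) 0 c` and `w ↦ fderiv ℝ (fun a => πN (V a w)) 0 c` are `C^∞`;
(3) they are related by the chart change `w ↦ w⁻¹` off `0`; (4)/(5) around each `(0, z)` there is
an open `S ⊆ ball 0 ε ×ˢ univ` mapped into `N` by `(a, z) ↦ U a z` on which `(a, z) ↦ πN (U a z)` is
flat-`C^∞`, and likewise for `V`. [cite: Wendl2018, Prop. 2.53] -/
theorem helper_normalVelocitySmooth : ∀ (X : Type) [TopologicalSpace X] [T2Space X] [SecondCountableTopology X] [ChartedSpace (EuclideanSpace ℝ (Fin 4)) X] [IsManifold (𝓡 4) ∞ X] (u₀ v₀ : ℂ → X) (N : Set X) (πN : X → ℂ) (ε : ℝ) (U V : ℂ → ℂ → X), IsOpen N → Set.range u₀ ∪ {v₀ 0} ⊆ N → ContMDiffOn (𝓡 4) 𝓘(ℝ, ℂ) ∞ πN N → 0 < ε → (∀ z, U 0 z = u₀ z) → (∀ w, V 0 w = v₀ w) → (∀ a : ℂ, ‖a‖ < ε → ∀ z : ℂ, z ≠ 0 → V a z = U a z⁻¹) → ContMDiffOn 𝓘(ℝ, ℂ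 × ℂ) (𝓡 4) ∞ (fun q : ℂ × ℂ => U q.1 q.2) (Metric.ball 0 ε ×ˢ Set.univ) → ContMDiffOn 𝓘(ℝ, ℂ × ℂ) (𝓡 4) ∞ (fun q : ℂ × ℂ => V q.1 q.2) (Metric.ball 0 ε ×ˢ Set.univ) → ∀ c : ℂ, ContDiff ℝ ∞ (fun z : ℂ => fderiv ℝ (fun a : ℂ => πN (U a z)) 0 c) ∧ ContDiff ℝ ∞ (fun w : ℂ => fderiv ℝ (fun a : ℂ => πN (V a w)) 0 c) ∧ (∀ w : ℂ, w ≠ 0 → fderiv ℝ (fun a : ℂ => πN (V a w)) 0 c = fderiv ℝ (fun a : ℂ => πN (U a w⁻¹)) 0 c) ∧ (∀ z : ℂ, ∃ S : Set (ℂ × ℂ), IsOpen S ∧ ((0 : ℂ), z) ∈ S ∧ S ⊆ Metric.ball 0 ε ×ˢ Set.univ ∧ Set.MapsTo (fun q : ℂ × ℂ => U q.1 q.2) S N ∧ ContDiffOn ℝ ∞ (fun q : ℂ × ℂ => πN (U q.1 q.2)) S) ∧ (∀ w : ℂ, ∃ S : Set (ℂ × ℂ), IsOpen S ∧ ((0 :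 ℂ), w) ∈ S ∧ S ⊆ Metric.ball 0 ε ×ˢ Set.univ ∧ Set.MapsTo (fun q : ℂ × ℂ => V q.1 q.2) S N ∧ ContDiffOn ℝ ∞ (fun q : ℂ × ℂ => πN (V q.1 q.2)) S) := by
  intro X _ _ _ _ _ u₀ v₀ N πN ε U V hN hsub hπ hε hU0 hV0 hUV hU hV c
  -- the common open parameter domain `W := ball 0 ε ×ˢ univ` and its base points `(0, z)`
  have hW : IsOpen (Metric.ball (0 : ℂ) ε ×ˢ (univ : Set ℂ)) := Metric.isOpen_ball.prod isOpen_univ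
  have hmemW : ∀ z : ℂ, ((0 : ℂ), z) ∈ Metric.ball (0 : ℂ) ε ×ˢ (univ : Set ℂ) := fun z =>
    ⟨Metric.mem_ball_self hε, mem_univ z⟩
  -- the base sphere lies in `N`, in both charts
  have hUN : ∀ z : ℂ, (fun q : ℂ × ℂ => U q.1 q.2) ((0 : ℂ), z) ∈ N := fun z => by
    show U 0 z ∈ N
    rw [hU0 z]
    exact hsub (mem_union_left _ (mem_range_self z))
  have hVN : ∀ w : ℂ, (fun q : ℂ × ℂ => V q.1 q.2) ((0 : ℂ), w) ∈ N := fun w => by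
    show V 0 w ∈ N
    by_cases hw : w = 0
    · rw [hw, hV0 0]
      exact hsub (mem_union_right _ (mem_singleton _))
    · rw [hUV 0 (by simpa using hε) w hw, hU0]
      exact hsub (mem_union_left _ (mem_range_self _))
  -- (4), (5): the local flat packagings
  have hSU : ∀ z : ℂ, ∃ S : Set (ℂ × ℂ), IsOpen S ∧ ((0 : ℂ), z) ∈ S ∧
      S ⊆ Metric.ball 0 ε ×ˢ Set.univ ∧ Set.MapsTo (fun q : ℂ × ℂ => U q.1 q.2) S N ∧
      ContDiffOn ℝ ∞ (fun q : ℂ × ℂ => πN (U q.1 q.2)) S := fun z =>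
    exists_isOpen_mapsTo_contDiffOn hW hN hU hπ (hmemW z) (hUN z)
  have hSV : ∀ w : ℂ, ∃ S : Set (ℂ × ℂ), IsOpen S ∧ ((0 : ℂ), w) ∈ S ∧
      S ⊆ Metric.ball 0 ε ×ˢ Set.univ ∧ Set.MapsTo (fun q : ℂ × ℂ => V q.1 q.2) S N ∧
      ContDiffOn ℝ ∞ (fun q : ℂ × ℂ => πN (V q.1 q.2)) S := fun w =>
    exists_isOpen_mapsTo_contDiffOn hW hN hV hπ (hmemW w) (hVN w)
  refine ⟨?_, ?_, ?_, hSU, hSV⟩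
  · -- (1): smoothness of `σ`, pointwise from the local packaging around `(0, z₀)`
    rw [contDiff_iff_contDiffAt]
    intro z₀
    obtain ⟨S, hS, h0, -, -, hg⟩ := hSU z₀
    exact contDiffAt_fderiv_apply hS h0 hg c
  · -- (2): smoothness of `σ'`
    rw [contDiff_iff_contDiffAt]
    intro w₀
    obtain ⟨S, hS, h0, -, -, hg⟩ := hSV w₀
    exact contDiffAt_fderiv_apply hS h0 hg c
  · -- (3): the chart-change relation at the level of `a`-derivatives
    intro w hw
    rw [fderiv_zero_eq_of_eqOn_ball hε fun a ha => by rw [hUV a ha w hw]]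

end Summit.SmoothPoincare4.SmoothPoincare4.Theorems.GromovRecognitionRelEnd.CrossCapLaurent
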